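import Mathlib
import HarnessLib
import HarnessLib.Audit
import Summits.ValiantsHypothesis.Statement
import Literature.Computability.Complexity.CircuitComposition

/-!
Route: AnyonJets

DORMANT since 2026-09-04T23:01:06Z (reconciler: no traction for 5 d (last activity statement-checked at 2026-08-30T22:11:37Z); parked, not closed — `ledger route dormant route-ValiantsHypothesis-AnyonJets --off` to reactivate) — unstaffed, not closed; items shared with open routes are served there. `ledger route dormant <id> --off` reactivates.

# Route AnyonJets — flat anyonic jets — per is the (−2)-resummation of easy inversion-jets of det;
VH from constant-free jet growth plus constant elimination inside VP

Deform det to per along the INVERSION (anyonic / Mahonian) pencil P(q;X) = Σ_σ q^(inv σ) Π_i X(σ i,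
i) (q = −1 det, q = 1 per, q = 0 one
monomial; inv σ = #{i<j : σ j < σ i}, inlined, rfl-equal to `inversionNumber`) and expand at the
fermion point: the k-th ANYONIC JET
J_(n,k) := Σ_σ sgn(σ)·C(inv σ, k)·x^σ satisfies P(−1+u;X) = Σ_k (−u)^k J_k and per_n = Σ_(k ≤
C(n,2)) (−2)^k J_(n,k) (Resummation), and
EVERY jet is easy — J_(n,k) ∈ VP⁰ with constant-free size n^(4k+O(1))·(2k)! (JetFlatness: inv is
2-local, so k marked inversion pairs touch
≤ 2k columns and the rest is a Laplace expansion of det). It suffices to show X =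
JetExponentUnbounded: for every c some FIXED jet J_k has
complex circuit complexity > n^c for infinitely many n ("the anyonic perturbation series of per
around det cannot be summed with uniformly
cheap terms"). X is reached from two cruxes that split it along the constant question:
ConstantFreeJetGrowth (the same statement for
constant-free complexity — the ⊕W[1]/per-mod-2^k-safe half, since per ≡ Σ_(j<k) (−2)^j J_j (mod
2^k)) and JetConstantElim (complex
constants speed up the explicit EASY families J_k, k ≤ log₂ n, by at most a k-independent
polynomial). With UniformJetUpperBound (VP = VNP
⇒ all jets uniformly n^c-easy: the pencil is p-definable, interpolate in q) X contradicts VP = VNP.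
Cards realised: anyon-pencil-flat-fermion
(spine: pencil, jets, resummation, 2-adic shadow, fibre criterion) and its companion
crossing-pencil-free-and-fermion (matching side: twist
identity CrossingNestingTwist; the J-ladder here is the bipartite slice of its nesting ladder),
routed together as the triage asked.
Lean: `let J := fun (n k : ℕ) => (∑ σ : Equiv.Perm (Fin n), MvPolynomial.C (((Equiv.Perm.sign σ :
ℤˣ) : ℤ) * (((Finset.univ.filter (fun p : Fin n × Fin n => p.1 < p.2 ∧ σ p.2 < σ p.1)).card.choose k
: ℕ) : ℤ)) * ∏ i : Fin n, MvPolynomial.X (σ i, i) : MvPolynomial (Fin n × Fin n) ℤ); ∀ c : ℕ, ∃ k :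
ℕ, ∀ n₀ : ℕ, ∃ n : ℕ, n₀ ≤ n ∧ n ^ c < Literature.Computability.AlgebraicComplexity.complexity
(MvPolynomial.map (Int.castRingHom ℂ) (J n k))`

## Assembly
Pure ℕ-arithmetic, certified: `closes (hCF : ConstantFreeJetGrowth) (hCE : JetConstantElim) (hU :
UniformJetUpperBound) : ValiantsHypothesis`
(glue.lean = Sketch.lean `closes`, lean check rc 0, 0 sorries). `ValiantsHypothesis` unfolds to VP ℂ
≠ VNP ℂ; assume equality; hU gives c, n₀ with
L_ℂ(J_(n,k)) ≤ n^c for n ≥ n₀ and all k; hCE gives b; hCF at c' := (c+2)b + 1 gives a fixed k ≥ 1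
and some n ≥ max(n₀, 2^k, 3) with
n^(c') ≤ τ(J_(n,k)) ≤ (L_ℂ + n + 2)^b ≤ (n^(c+2))^b = n^((c+2)b) < n^(c'), absurd. The target X is
derived inside the same arithmetic
(CF ∧ CE ⇒ X ⇒ ¬(uniform bound)); JetCostGrowthC ⇒ X is `growthCToTarget_holds`; the 2-adic/Boolean
supports feed CF (BooleanShadowToCF);
NoThirdEasyFibre, TranscendentalFibre, CrossingNestingTwist are structure and do not enter the
deduction.

Rationale: WHY THIS LINE. The determinant has an infinitely FLAT easy formal neighbourhood in the inversion
direction — every Taylor coefficient J_k at q = −1 is a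
two-line Laplace object in VP⁰ (verified exactly for n ≤ 5 together with per = Σ(−2)^k J_k, J_1 =
two-column half-expansion, per ≡ det − 2J_1
mod 4) — yet the finite resummation at u = −2 is the permanent; so Valiant's hypothesis becomes a
statement about the GROWTH RATE of one explicit
ladder of easy polynomials (HungKuo2023 study the same pencil Booleanly: Mod_pP-hardness at ζ_(p^k),
no VP/VNP statement; the cycle-statistic
pencil of route FermionicJet has the opposite local geometry, a conjecturally hard first jet). The
2-adic shadow per ≡ Σ_(j<k)(−2)^j J_j (mod 2^k)
is the division-free algebraic form of Valiant's per-mod-2^k algorithm (Valiant1979Permanent §4,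
BjorklundHusfeldtLyckberg2017) and transfers
Curticapean–Xia's ⊕W[1]-hardness of per mod 2^k (CurticapeanXia2015) to the CONSTANT-FREE jet
exponents (support BooleanShadowToCF), which is why
the thesis is split into a constant-free growth crux (fine-grained-safe, technique-free) and a
constant-elimination crux that lives INSIDE VP
(explicit easy integer families, k-uniform exponent) instead of at the permanent (TauConst's
TauConstElim stmt-0335, which the full-range form of
the same statement would imply; BhattacharjeeEtAl2026 p.7 records the VP⁰/VP relation as unclear).
Imported: q-deformation / quantum determinants
(per_n is also the normally-ordered symbol of the central group-like quantum determinant of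
O_(−1)(M_n), FRT relations at q = −1: same-row/column
entries anticommute, others commute — equivalently per = Θ(det) for the quadratic-phase Hadamard
operator (−1)^(inv), inv a quadratic form on the
permutation matrix; a dictionary remark locating all hardness in normal ordering, no lower bound is
drawn from it), parameterized counting
complexity (BlaeserEngels2019, CurticapeanXia2015) for the quantitative spine, Bürgisser's Boolean
simulation of integer circuits (in tree,
`cktSize_testBits_aeval_eval`) for the shadow, and (q,t)-Gaussian / crossing–nesting combinatorics
(Blitvic2012) for the matching side.
No open route uses the inversion pencil, a flat-jet ladder, or constant elimination inside VP; the
negatives index (stmt-0340, 3735, 3738, 5668: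
elusive curve, Grenet uniqueness ×2, UlrichPadded tightness) is disjoint from every statement here.
RE-GLUE (rev 3, 2026-08-27, director-valiant g9 GO on prover 16737-p1's kernel bypass
p582854/p583838/p584331/p584717; tenure planner
tenure-valiant-dormant-sweep g7): `closes` is now `closes_ultimate_twoAdic` transplanted —
hypotheses ConstantFreeJetGrowthUltimate (CF^ult:
constant-free growth of every 2-adically shallow integral multiple M·J_(n,k), v₂(M) ≤ n^c) and
JetConstantElimTwoAdic (CE^ult₂: constant
elimination for the jets up to such a shallow multiple) replace ConstantFreeJetGrowth (CF) and
JetConstantElim (CE); UniformJetUpperBound (proved)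
stays. Landed comparisons: CE ⇒ CE^ult ⇒ CE^ult₂ (`jetConstantElimUltimate_of_jetConstantElim`,
`jetConstantElimUltimateTwoAdic_of_ultimate`) and
CF^ult ⇒ CF (`cfGrowth_of_ultimate`), PerModPowBooleanHard ⇒ CF^ult
(`cfUltimate_of_perModPowBooleanHard`: multipliers dissolve in the Boolean
shadow). Why: the registered line of CE needed a multiplier-REMOVAL stub (VP⁰ integer division) that
is conjecture-grade and conditionally refuted
in tree (MR ∧ CF ⊢ τ(PER) superpolynomial, p581999) — the re-glue takes it off the critical path at
the price of strengthening the CF-side binder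
only to what its sole evidence (PMPBH) already gives. The honest label is unchanged: VH ⇐ CE^ult₂
(ATTACKED conjunct; one open stub
integralMultiple₂) ∧ CF^ult (RESIDUAL, ⊕W[1]-type, not implied by VH — its ∃k∀n₀∃n shape is stronger
than TwoAdicLadder's VH-implied
PrecisionLadder) ∧ U (proved). CF and CE stay in the file as asides (CF a corollary of CF^ult; CE
bypassed, its landed stubs
stub_algebraicDescent p575059 / stub_signSimulation p575638 are reused verbatim by the CE^ult₂
line).

RANKED CRUXES. #0 JetExponentUnbounded (target) — X — for every c there is a FIXED order k such that
the k-th anyonic jet J_(n,k) (mapped to ℂ) has fan-in-two circuit complexity > n^c for infinitely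
many n; equivalently no k-uniform polynomial bound on the complex complexity of the fixed-order jets
(cards: "VH iff jet cost diverges", in its weakest VH-implying form). (why it might fail: Every
fixed jet might have ℂ-circuits of size n^c₀ with c₀ independent of k (an FPT-uniform algorithm
using complex constants or fast rectangular matrix multiplication on the n^(2k) marked-pair Laplace
terms); then X fails while VH can still hold.) [HungKuo2023, CurticapeanXia2015, DeRugyAltherre2013,
Valiant1979]
#2 JetConstantElim (ASIDE since rev 3 — bypassed by #5 JetConstantElimTwoAdic, which it implies;
kept for its registered line Cruxes/JetConstantElim/Lines/birth.lean whose landed stubs the new line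
reuses; not staffed) — CONSTANT ELIMINATION INSIDE VP FOR THE JETS (card K1, algebraic half): there
is one exponent b such that for all n and all k ≤ log₂ n the constant-free complexity of J_(n,k) is
at most (L_ℂ(J_(n,k)) + n + 2)^b — complex constants buy at most a k-INDEPENDENT polynomial on the
explicit easy integer families J_k (each already in VP⁰ with τ ≤ n^(4k+O(1))(2k)!). Ranked first: it
is the genuinely algebraic residue of the line and informative either way (a refutation is an
unbounded VP_ℂ/VP⁰ gap on explicit easy polynomials). [difficulty: open-problem] (why it might fail:
Roots of unity or fast-matrix-multiplication constants might save an unbounded polynomial factor on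
the easy integer families J_k — a VP_ℂ versus VP⁰ gap INSIDE VP at fixed-polynomial granularity;
nothing in print excludes it, and the full-range (all k) form already implies TauConstElim.)
[Burgisser2000, KoiranPerifel2011, BhattacharjeeEtAl2026, Koiran2004, Burgisser2009]
#3 ConstantFreeJetGrowth (ASIDE since rev 3 — corollary of #6 ConstantFreeJetGrowthUltimate at M =
1, `cfGrowth_of_ultimate`; not staffed) — CONSTANT-FREE JET GROWTH (card K1, arithmetic half, io
form): for every c there is a fixed k ≥ 1 with τ(J_(n,k)) ≥ n^c for infinitely many n (τ =
constant-free fan-in-two complexity over ℤ). Fine-grained-safe: by the 2-adic shadow per ≡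
Σ_(j<k)(−2)^j J_j (mod 2^k) and Boolean simulation, its failure puts per mod 2^k into k-uniform
polynomial-size Boolean circuits (support BooleanShadowToCF). [difficulty: open-problem] (why it
might fail: As a theorem it needs explicit fixed-polynomial constant-free lower bounds (n^c for
every c at some fixed k) — no technique beyond Baur–Strassen exists; it is false outright only if
per mod 2^k has n^O(1)-size Boolean circuits uniformly in k (nonuniform collapse of CX15's
⊕W[1]-hardness).) [CurticapeanXia2015, Valiant1979Permanent, BjorklundHusfeldtLyckberg2017,
BlaeserEngels2019]
#4 UniformJetUpperBound (crux) — UNIFORM JET UPPER BOUND (theorem on paper, filed as crux because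
`closes` consumes it): if VP_ℂ = VNP_ℂ then there are c, n₀ with L_ℂ(J_(n,k)) ≤ n^c for all n ≥ n₀
and ALL k — the pencil Σ_σ q^(inv σ) x^σ (q a variable) is a 0/1-coefficient p-family, hence in VNP
by Valiant's criterion, hence in VP, and J_(n,k) = (−1)^k [u^k] P(−1+u;X) costs C(n,2)+1 evaluations
by Lagrange interpolation in u. [difficulty: L] (why it might fail: Mathematics is Valiant 1979 +
Lagrange; only the transcription can fail — VNP-membership of the pencil via
`isVNPFamily_circuitSum` (inversion test as a B₂-circuit) and an interpolation cost lemma for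
`complexity` (eval at a constant, sums) must be formalised.) [Valiant1979, Burgisser2000,
Strassen1973, HungKuo2023]
#5 JetConstantElimTwoAdic (crux, ATTACKED conjunct of `closes` since rev 3) — CE^ult₂: there is b
such that for all n and k ≤ log₂ n some M ≥ 1 with v₂(M) ≤ (L_ℂ(J_(n,k))+n+2)^b has τ(M·J_(n,k)) ≤
(L_ℂ(J_(n,k))+n+2)^b. Registered content: `jetConstantElimUltimateTwoAdic_of : stub_algebraicDescent
(LANDED) → stub_integralMultiple₂ (OPEN: near-optimal number-field circuits for the jets can be
renormalised to constants over a common denominator of polynomially bounded 2-adic valuation — free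
when the constants are algebraic integers or the denominator is odd) → stub_signSimulation (LANDED)
→ CE^ult₂` (Theorems/AnyonJetsJetConstantElimMultiplierBypassTwoAdic.lean). Same kernel as
TwoAdicLadder's TwoIntegralNormalisation/stub_halfElim (ScaledHalfElimPoly + PolyDivision;
…TwoIntegralNormalisationHalfElimKernel/ClearingBound/Denominators/PolyHeight.lean; bracketed by
halfElimGlobal_of_tauConstElim ⇐ TauConst 0335 and halfElim_of_expHard) — to be imported, not
rebuilt. [difficulty: open-problem] (why it might fail: a near-optimal circuit for J_(n,k) may need
algebraic constants with exponentially deep 2-power denominators (2^(−2^s)-type), and no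
renormalisation to shallow constants is known outside the τ(PER)-easy world (Bürgisser 2009 Thm
2.10, KP2011 Rem. 4) — an unbounded VP_ℚ̄ vs shallow-multiple-VP⁰ gap on the explicit easy jets
refutes it.) [KoiranPerifel2011, Burgisser2009, Burgisser2000]
#6 ConstantFreeJetGrowthUltimate (crux, RESIDUAL conjunct since rev 3; evidence
PerModPowBooleanHard) — CF^ult: for every c a FIXED k ≥ 1 such that for infinitely many n every M ≥
1 with v₂(M) ≤ n^c has n^c ≤ τ(M·J_(n,k)). Consistent with every ceiling in tree (JetFlatness
τ(J_(n,k)) = n^O(k), CeilingAllPrecisions); NOT the refuted stmt-21028 OddPerNotVPF2 (every-exponent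
hardness at fixed precision k = 1, killed by the n⁴·L(det) circuit) — CF^ult lets each fixed k be
n^O(k)-easy and denies only a k-uniform exponent; not implied by VH (∃k before ∀n₀∃n). [difficulty:
open-problem] (why it might fail: as a theorem it is an explicit fixed-polynomial constant-free
lower bound at a fixed jet order — nothing beyond Baur–Strassen; through PMPBH it is a
fixed-polynomial Boolean lower bound for a P-function, beyond gate elimination; false iff the
shallow multiples of the jets have constant-free circuits of one exponent uniformly in k, a
nonuniform collapse of CX15's ⊕W[1]-hardness.) [CurticapeanXia2015, Valiant1979Permanent,
BjorklundHusfeldtLyckberg2017, BlaeserEngels2019]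
#9 Resummation (support) — per_n = Σ_(k=0)^(C(n,2)) (−2)^k J_(n,k) in ℤ[x] (termwise: sgn
σ·(1−2)^(inv σ) = 1; inv σ ≤ n(n−1)/2 so the binomial sum is complete); verified exactly for n ≤ 5
(scratch/verify2.py) and carried by triage-22/23 of the card. [difficulty: provable-now]
[HungKuo2023, Valiant1979]
#9 JetFlatness (support) — THE LEVER (card P1): J_(n,k) has constant-free circuits of size ≤
(n+2)^(4k+c₀)·(2k+2)! — J_k = Σ over k-sets S of marked inversion pairs (column pairs) of Σ_(σ ⊇
S-inverted) sgn σ x^σ, and for fixed S with touched columns C (|C| ≤ 2k) the inner sum is a Laplace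
expansion of det along the columns C with the S-inverted half of each small block kept (≤ n^(2k)
sets S, ≤ n^(2k) row sets, ≤ (2k)! small bijections, one division-free det of the complementary
minor); for k ≥ n/4 the monomial-by-monomial circuit is below the bound. J_1 formula verified for n
≤ 5, J_2 decomposition for n = 4, 5. [difficulty: L] [Valiant1979Permanent, Burgisser2000,
HungKuo2023]
#9 TwoAdicShadow (support) — 2-ADIC SHADOW (card P2; offered to route TwoAdicLadder as its missing
algebraic n^O(k) support): per_n − Σ_(k<a)(−2)^k J_(n,k) ∈ 2^a·ℤ[x] for all n, a (from Resummation);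
a = 2: per ≡ det − 2J_1 (mod 4), verified n ≤ 5. [difficulty: provable-now] [Valiant1979Permanent,
BjorklundHusfeldtLyckberg2017, CurticapeanXia2015]
#9 PerModPowBooleanHard (support) — BOOLEAN FAR SIDE (believed; CurticapeanXia2015 made nonuniform):
for every c some fixed k ≥ 1 has: the k low bits of the 0/1 permanent (per mod 2^k, permutation
count inlined as in `permCount`) admit no B₂-circuits of size ≤ n^c for infinitely many n. Open (any
c ≥ 2 is an explicit fixed-polynomial Boolean lower bound) but a consequence of nonuniform
⊕W[1]-type hypotheses; filed so that the constant-free crux has a typed evidence chain. [difficulty: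
open-problem] [CurticapeanXia2015, Valiant1979Permanent, BjorklundHusfeldtLyckberg2017]
#9 BooleanShadowToCF (support) — the Boolean far side implies ConstantFreeJetGrowth: if for some c
every fixed j had τ(J_(n,j)) < n^c eventually, then for each k the polynomial Σ_(j<k)(−2)^j J_j (≡
per mod 2^k by TwoAdicShadow; J_0 = det constant-free in n^O(1)) has constant-free size k·n^c +
n^O(1), and Bürgisser's simulation `cktSize_testBits_aeval_eval` (p = 2^k) gives B₂-circuits of size
n^(c+O(1)) for per mod 2^k, eventually, for every k — contradicting PerModPowBooleanHard; pigeonhole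
is unnecessary in the io form. [difficulty: provable-now] [Burgisser2000TCS, CurticapeanXia2015,
Valiant1979Permanent]
#9 JetCostGrowthC (support) — the card's K1 over ℂ in its strong (tail, eventual) form: there are a,
n₀ with n^k ≤ L_ℂ(J_(n,k))^a for all n ≥ n₀ and 1 ≤ k ≤ log₂ n — the jet-cost exponent grows
linearly in k along k ≤ log n. Implies the target (GrowthCToTarget, proved in Sketch.lean) and is
implied by ConstantFreeJetGrowth-type growth plus JetConstantElim; filed as the direct (split-free)
milestone, subject to the rank-method barriers the card concedes. [difficulty: open-problem]
[HungKuo2023, CurticapeanXia2015, BlaeserEngels2019]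
#9 GrowthCToTarget (support) — JetCostGrowthC → JetExponentUnbounded (ℕ-arithmetic: at k = c·a + 1
and n ≥ 2^k + 2, n^(ca+1) ≤ L^a and L ≤ n^c are incompatible); proved sorry-free as
`growthCToTarget_holds` in the planner's Sketch.lean. [difficulty: provable-now] [Burgisser2000]
#9 NoThirdEasyFibre (support) — card K2 in implication form (structural, not load-bearing for
`closes`): for algebraic z ∉ {0, 1, −1} the fibre (P(z;X_n))_n of the inversion pencil is a VP
family only if the permanent is — every non-flat algebraic anyon is as hard as the boson (expected
via VNP-completeness under c-reductions; Hung–Kuo have Boolean Mod_pP-hardness at ζ_(p^k), odd p,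
and leave real z and composite orders open). [difficulty: open-problem] [HungKuo2023,
DeRugyAltherre2013, Curticapean2021, MertensMoore2013]
#9 TranscendentalFibre (support) — card P3 (fibre criterion, nontrivial direction): for
transcendental z, if (P(z;X_n))_n is a VP family then so is the permanent — for a fixed size bound
the easy locus {q₀ : P(q₀;X_n) has a size-s circuit} is ℚ-constructible (Chevalley over the finitely
many skeletons), hence finite-algebraic or cofinite, and a transcendental easy point makes it
cofinite, so per = P(1) is Lagrange-interpolated from C(n,2)+1 easy fibres; hence VH ⟺ hardness of
any transcendental (equivalently the generic) anyon permanent. [difficulty: L] [HungKuo2023,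
Burgisser2000, Valiant1979]
#9 CrossingNestingTwist (support) — companion card crossing-pencil-free-and-fermion, twist identity
behind the reduction of the (q,t)-Wick plane to ONE crossing pencil: for a perfect matching M of Fin
(2n) (fixed-point-free involution), Σ_(openers a<Ma) (Ma − a − 1) = 2·(cr(M) + ne(M)) (each interior
point of an arc is an endpoint of a nested arc — two per nesting — or of a crossing arc — one per
side); hence (−1)^(ne) = (−1)^(cr)·Π i^(b−a−1), the fermion line of twisted Pfaffians and Hf = Σ 2^k
Ĵ_k, NN = Σ_k J^(ne)_k (route FifoMatching's NN, stmt-11615/11616); verified on all 1/3/15/105/945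
matchings of [2],…,[10]. [difficulty: provable-now] [Blitvic2012, Valiant1979]

TWO-LAYER PLAN. Foreseen glued splits (k ≤ 3, depth 1), none filed now: UniformJetUpperBound ⇐
PencilInVNP (Valiant's criterion for Σ_σ q^(inv σ) x^σ via
`isVNPFamily_circuitSum` + difference closure) → InterpolationCost (L_ℂ([u^k]F) ≤ (deg_u F +
1)(L_ℂ(F) + O(1)) for eval-at-constants) → UJUB;
JetConstantElimTwoAdic ⇐ stub_algebraicDescent (landed) → stub_integralMultiple₂ (the one open stub:
2-adically shallow common denominator for
the number-field constants) → stub_signSimulation (landed) — registered as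
`jetConstantElimUltimateTwoAdic_of` (rev 3; supersedes the rev-2 plan
HeightNormalForm → IntegralToSignConstants → CE, whose multiplier-removal step is off the critical
path); ConstantFreeJetGrowth ⇐
PerModPowBooleanHard → BooleanShadowToCF (both filed as supports already: the Boolean far side is
where parameterized counting complexity can
be imported wholesale). If CE^ult₂ dies but JetCostGrowthC survives, re-glue `closes` to
(JetCostGrowthC)(UniformJetUpperBound) via GrowthCToTarget.

KILL CRITERIA. (i) A k-uniform polynomial bound L_ℂ(J_(n,k)) ≤ n^c₀ for all fixed k (e.g. an
FPT-uniform complex algorithm for inversion-marked Laplace sums)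
refutes the target X and closes the route (`close --reason refuted:JetExponentUnbounded`); the
pencil would then be 'flat at quasi-uniform cost'
and the 2-adic side survives only constant-freely (hand CF/TwoAdicShadow to route TwoAdicLadder).
(ii) An explicit unbounded gap between VP_ℚ̄-cost and the constant-free cost of EVERY
2-adically shallow multiple on the families J_k (k ≤ log₂ n) refutes JetConstantElimTwoAdic (since
rev 3 the binder; a gap for M = 1 alone only
refutes the aside JetConstantElim): pivot to the split-free line (JetCostGrowthC as crux, re-glued
closes) or close refuted:JetConstantElimTwoAdic
if the gap mechanism also bounds L_ℂ uniformly. (iii) A constant-free bound of ONE exponent, uniform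
in the fixed jet order k, for some shallow
multiples M_n·J_(n,k) refutes ConstantFreeJetGrowthUltimate (and for M = 1 the aside
ConstantFreeJetGrowth, which through BooleanShadowToCF puts
per mod 2^k in nonuniform FPT-size Boolean circuits — a nonuniform collapse of Curticapean–Xia's
⊕W[1]-hardness); close
refuted:ConstantFreeJetGrowthUltimate unless a VH-implied variant with k = k(n) (TwoAdicLadder's
PrecisionLadder shape) can be re-glued. (iv) per ∈ VP (¬VH) moots everything; a third easy ALGEBRAIC
fibre (NoThirdEasyFibre refuted at some z)
changes the picture but not `closes`.

NOT DECOMPOSED YET. The eventual (rather than io) and linear-in-k (n^(αk)) forms of the growth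
cruxes; the per-k exponent table e(k), e⁰(k) for k = 1, 2, 3
(first informative rung: is τ(J_(n,2)) superquadratic in N = n²? — a superlinear explicit bound,
deliberately not filed); VNP-completeness of
algebraic fibres under c-reductions (kept as the implication-form support NoThirdEasyFibre; an
oracle-circuit notion is not in the tree); the
matching-side ladders C_j (j-crossing sums at the free point) and Ĵ_k, J^(ne)_k (Pfaffian-side jets)
of the companion card and the NN =
Σ_k J^(ne)_k bridge to route FifoMatching (stmt-11615/11616) — only the twist identity is filed; the
Hecke-algebra reading (P = index character
of H_n(q) applied to the generic element; jets = derivatives where ind_q collides with sgn_q at q =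
−1) and the O_(−1)(M_n) quantum-determinant
/ quadratic-phase dictionary — interpretive, no item; constants in JetFlatness (c₀) and the
simulation overhead in BooleanShadowToCF. Since rev 3 also: the VH-implied
weakening of CF^ult with k = k(n) ≤ log₂ n (would need CE^ult₂ unchanged) or k(n) ≤ C(n,2) (would
need CE^ult₂ for all k) — not filed; the exact
relation of stub_integralMultiple₂ to TwoAdicLadder's ScaledHalfElimPoly/PolyDivision split (same
kernel, different family: jets vs per) — a
prover's import, not an item; the multiplier-removal statement MR of the rev-2 line
(conjecture-grade, conditionally refuted) — abandoned, not filed.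

CHEAPEST FALSIFIER. Since rev 3, for the binder CE^ult₂: an explicit integer VP_ℚ̄-family provably
needing 2-adically deep constants up to every shallow multiple — toy candidates are the
half-binomials ((x+1)^(2^s) − x^(2^s) − 1)/2 and iterated halvings (none known to be hard
constant-free; KP2011 Rem. 4); for CF^ult: an FPT-type (one exponent, all k) algorithm for per mod
2^k or for the shallow jet multiples. Rev-2 text: An n^c₀-size (c₀ independent of k) complex circuit
family for the fixed-order jets J_(n,k) — first place to look: fast rectangular matrix
multiplication / inclusion–exclusion over the n^(2k) marked column-pair sets, or an FPT algorithm
for per mod 2^k with complex advice — kills X;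
a polynomial-size circuit for one algebraic fibre P(ζ₃;X), P(ζ₄;X), P(1/2;X) kills the 'two flat
points only' picture (NoThirdEasyFibre), not
`closes`. Run this session (passed): per = Σ(−2)^k J_k, J_0 = det, P(−1+u) = Σ(−u)^k J_k, J_1 =
two-column Laplace half-expansion, per ≡ det −
2J_1 (mod 4) and the marked-pair decomposition of J_2, exactly for n ≤ 5 (scratch/verify2.py,
verify3.py); the twist identity on all perfect
matchings of [2..10]; literature lookups for a VP⁰-vs-VP_ℂ gap on explicit integer p-families (none;
arXiv:2601.00387 p.7 'unclear') and for an
n^(o(k)) algorithm for per mod 2^k / inversion jets (none; CX15 ⊕W[1]-hard); Sketch.lean rc 0,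
`closes` kernel-checked.

NUMBERS. Jets: C(n,2)+1 of them; J_0 = det_n, J_(C(n,2)) = ±x^(w₀); τ(J_(n,k)) ≤ n^(4k+O(1))·(2k)!
(JetFlatness), so e⁰(k) ≤ 4k+O(1); coefficients
|C(inv σ,k)| ≤ C(C(n,2),k). Boolean shadow: per mod 2^k of integer matrices in time O(n^(4k−3))
(Valiant 1979) and n^(k+O(1)) (BHL 2017);
⊕W[1]-hard parameterized by k (Curticapean–Xia 2015). Pencil: deg_q P = C(n,2); easy fibres known: q
∈ {0, −1} (and q = 1 iff ¬VH);
Hung–Kuo: Mod_pP-hard Booleanly at primitive p^k-th roots of unity, odd p. Trivial floor: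
L_ℂ(J_(n,k)) ≥ (n² − O(1))/2 for 1 ≤ k ≤ C(n,2) − O(1)
(all variables occur). Matching side: |PM([2n])| = (2n−1)!!, Σ_arcs(b−a−1) = 2(cr+ne) checked
through n = 5.

DEFINITION REQUESTS. None required: every item inlines inv σ = #{(i,j) : i<j, σ j < σ i} (rfl-equal
to `Literature.Computability.AlgebraicComplexity.inversionNumber`,
NilCoxeterTensor.lean, deliberately not imported to keep the route's import cone at Statement +
Complexity.CircuitComposition) and the
permutation count of a 0/1 array (verbatim the body of `permCount`). Convenience abbreviations
`qPerPoly n R q` / `anyonJet n k` (card D1) may be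
proposed later under Literature/Computability/AlgebraicComplexity next to `inversionNumber`; no item
waits on them.

Novelty: Searches (2026-08-16): `lit search --source arxiv` ×4 ("parameterized Valiant classes" →
arXiv:1907.12287, 2108.12879, 2601.00387; "q-permanent
inversion complexity" / "quantum determinant permanent q=-1" → arXiv:2302.08083 only; "permanent
modulo powers of two complexity" → 0); `lit read
arxiv:2302.08083` (contributions p.3–5, open problems §7 p.21: no VP/VNP classification for z ∉
{±1}, real z and composite orders open), `lit read
arxiv:1907.12287` (no per-mod-2^k / constant-free bridge), `lit read arxiv:2601.00387` (p.7: "it is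
not clear whether VP⁰ ≠ VNP⁰ implies VP ≠
VNP"; constant-free parameterized classes); hub: all 67 Theses headers of the sub read (levers
tabulated in NOTES.md), `ledger idea list` (135
cards; anyon-pencil-flat-fermion + crossing-pencil-free-and-fermion OPEN, graded new-combination,
triage KEEP ×2, "route the pair as ONE thin route";
closed neighbours anyonic-jets-flat-fermion, crossing-nesting-atlas, det-unique-integrable-point
read), `ledger negatives` (4), `lean search` for
inversionNumber / constantFreeComplexity / CktSize / permCount; the card's own 2026-08-15 searches
(zbMATH q-permanent: Bapat–Lal, Lal, de Sá,
Mitchell, Fahssi 2026, Jing–Zhang; galaxy --star all) are inherited. searchd was down this session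
(rc 104/75); arXiv leg used.
Nearest prior art found: HungKuo2023 = arXiv:2302.08083 (same inversion pencil; Boolean
Mod_pP-hardness at ζ_(p^k); no jets, no VP/VNP);
CurticapeanXia2015 + Valiant1979Permanent + BjorklundHusfeldtLyckberg2017  [refs: 1907.12287, 2302.08083, 2601.00387, arxiv:2302.08083, arxiv:1907.12287, arxiv:2601.00387, HungKuo2023, CurticapeanXia2015, BjorklundHusfeldtLyckberg2017, BlaeserEngels2019, BhattacharjeeEtAl2026]

Barriers (technique_class: deformation-jets, q-analogue, constant-elimination): - technique_class: deformation-jets, q-analogue, parameterized-ladder, constant-elimination,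
two-adic
- Literature.Barriers.ValiantsHypothesis.PartialDerivativesDetPerm: it does not evade it for
JetCostGrowthC / the target over ℂ (J_k is supported on almost all permutation monomials with
coefficients ±C(inv,k); its flattening ranks along column cuts are expected to equal det's and
per's, so no flattening proves n^(ω_k(1))); the bet is the split: constant-free growth is to come by
transfer from Boolean parameterized hardness (BooleanShadowToCF) and constant elimination, not from
a distinguisher. Same answer for the rank-method files RankMethods / RankLiftingBarrier /
ShiftedPartialDerivatives (not catalogued decls).
- Literature.Barriers.ValiantsHypothesis.AlgebraicNaturalProofs: (conditional barrier) applies to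
the target at k ~ log n exactly as to VH — not evaded; the filed cruxes are fixed-k,
fixed-polynomial statements (CF, CE) where counting over finitely many constant-free skeletons and
Boolean transfer remain admissible and largeness is not an issue.
- Characteristic two (barrier file CharacteristicTwo.lean / `PermanentCharTwo`, not a catalogued
decl): evaded and used — the line STARTS from per ≡ det mod 2 and mod (q+1) and prices the departure
digit by digit (TwoAdicShadow); every statement is over ℤ, ℤ/2^a with a ≥ 2, or ℂ, none is
characteristic-free.
- Literature.Barriers.ValiantsHypothesis.NoncommutativeExtensions: not engaged — the O_(−1)(M_n) /
quantum-determinan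

History (route lifecycle, newest last):
- 2026-08-24T18:44:25Z · DORMANT — reconciler: no traction for 7 d (last activity item-evidence-added at 2026-08-17T18:32:33Z); parked, not closed — `ledger route dormant route-ValiantsHypothesis (operator:999:3436684)
- 2026-08-26T05:44:40Z · REACTIVATED — reconciler: reactivated — activity item-proof-filed at 2026-08-26T05:07:20Z after parking at 2026-08-24T18:44:25Z (operator:999:903062)
- 2026-09-04T23:01:06Z · DORMANT — reconciler: no traction for 5 d (last activity statement-checked at 2026-08-30T22:11:37Z); parked, not closed — `ledger route dormant route-ValiantsHypothesis-A (operator:999:2065100)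

sub-problem: ValiantsHypothesis · status: dormant · opened planner-plan-novel-ValiantsHypothesis-ValiantsH-5b693ca4-v2-g7-0 2026-08-16T20:47:15Z · rev 5 · ledger route-ValiantsHypothesis-AnyonJets
GENERATED by the gate from the ledger (D-0016/17). Provers cite these decls: `theorem foo : Summit.ValiantsHypothesis.ValiantsHypothesis.Theses.AnyonJets.<Decl> := …` in Summits/ValiantsHypothesis/ValiantsHypothesis/Theorems/<Name>.lean.
-/

namespace Summit.ValiantsHypothesis.ValiantsHypothesis.Theses.AnyonJets

open scoped BigOperators Topology Manifold Classical MeasureTheory ProbabilityTheory Matrix InnerProductSpace ComplexConjugate ContinuousMap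
open Filter Set Function TopologicalSpace MeasureTheory

attribute [summit_statement] _root_.ValiantsHypothesis

open Literature.PNP

/-- item stmt-ValiantsHypothesis-16736 · target · rank 0 · open · by planner
why it might fail: Every fixed jet might have ℂ-circuits of size n^c₀ with c₀ independent of k (an FPT-uniform algorithm using complex constants or fast rectangular matrix multiplication on the n^(2k) marked-pair Laplace terms); then X fails while VH can still hold.
sources: HungKuo2023, CurticapeanXia2015, DeRugyAltherre2013, Valiant1979
[target] X — for every c there is a FIXED order k such that the k-th anyonic jet J_(n,k) (mapped to
ℂ) has fan-in-two circuit complexity > n^c for infinitely many n; equivalently no k-uniform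
polynomial bound on the complex complexity of the fixed-order jets (cards: "VH iff jet cost
diverges", in its weakest VH-implying form). -/
@[route_item "route-ValiantsHypothesis-AnyonJets"]
def JetExponentUnbounded : Prop :=
  let J := fun (n k : ℕ) => (∑ σ : Equiv.Perm (Fin n), MvPolynomial.C (((Equiv.Perm.sign σ : ℤˣ) : ℤ) * (((Finset.univ.filter (fun p : Fin n × Fin n => p.1 < p.2 ∧ σ p.2 < σ p.1)).card.choose k : ℕ) : ℤ)) * ∏ i : Fin n, MvPolynomial.X (σ i, i) : MvPolynomial (Fin n × Fin n) ℤ); ∀ c : ℕ, ∃ k : ℕ, ∀ n₀ : ℕ, ∃ n : ℕ, n₀ ≤ n ∧ n ^ c < Literature.Computability.AlgebraicComplexity.complexity (MvPolynomial.map (Int.castRingHom ℂ) (J n k))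

/-- item stmt-ValiantsHypothesis-16739 · crux · rank 4 · closed · proved by Summit.ValiantsHypothesis.ValiantsHypothesis.Theorems.AnyonJets.uniformJetUpperBound_proof (prover) · by planner
why it might fail: Mathematics is Valiant 1979 + Lagrange; only the transcription can fail — VNP-membership of the pencil via `isVNPFamily_circuitSum` (inversion test as a B₂-circuit) and an interpolation cost lemma for `complexity` (eval at a constant, sums) must be formalised.
sources: Valiant1979, Burgisser2000, Strassen1973, HungKuo2023
[crux] UNIFORM JET UPPER BOUND (theorem on paper, filed as crux because `closes` consumes it): if
VP_ℂ = VNP_ℂ then there are c, n₀ with L_ℂ(J_(n,k)) ≤ n^c for all n ≥ n₀ and ALL k — the pencil Σ_σ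
q^(inv σ) x^σ (q a variable) is a 0/1-coefficient p-family, hence in VNP by Valiant's criterion,
hence in VP, and J_(n,k) = (−1)^k [u^k] P(−1+u;X) costs C(n,2)+1 evaluations by Lagrange
interpolation in u. [difficulty: L] -/
@[route_item "route-ValiantsHypothesis-AnyonJets"]
def UniformJetUpperBound : Prop :=
  let J := fun (n k : ℕ) => (∑ σ : Equiv.Perm (Fin n), MvPolynomial.C (((Equiv.Perm.sign σ : ℤˣ) : ℤ) * (((Finset.univ.filter (fun p : Fin n × Fin n => p.1 < p.2 ∧ σ p.2 < σ p.1)).card.choose k : ℕ) : ℤ)) * ∏ i : Fin n, MvPolynomial.X (σ i, i) : MvPolynomial (Fin n × Fin n) ℤ); Literature.Computability.AlgebraicComplexity.VP ℂ = Literature.Computability.AlgebraicComplexity.VNP ℂ → ∃ c n₀ : ℕ, ∀ n : ℕ, n₀ ≤ n → ∀ k : ℕ, Literature.Computability.AlgebraicComplexity.complexity (MvPolynomial.map (Int.castRingHom ℂ) (J n k)) ≤ n ^ c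

-- `UniformJetUpperBound` holds: proved by `Summit.ValiantsHypothesis.ValiantsHypothesis.Theorems.AnyonJets.uniformJetUpperBound_proof` (its module imports this route file, so no `_holds` link can be stated here).

/-- item stmt-ValiantsHypothesis-23655 · crux · rank 5 · open · by planner
why it might fail: A near-optimal circuit for J_(n,k) may need algebraic constants with exponentially deep 2-power denominators (2^(-2^s)-type); no renormalisation to 2-adically shallow constants is known outside the tau(PER)-easy world (Burgisser2009 Thm 2.10, KP2011 Rem 4): such a gap on the easy jets refutes it.
sources: KoiranPerifel2011, Burgisser2009, Burgisser2000
[crux] CE^ult₂ — JET CONSTANT ELIMINATION UP TO A 2-ADICALLY SHALLOW INTEGRAL MULTIPLE (the ATTACKED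
conjunct of the re-glued `closes`; director-valiant g9 GO 2026-08-27T23:23:51Z on 16737-p1's kernel
bypass p582854/p583838/p584331/p584717): there is b such that for all n and k ≤ log₂ n some M ≥ 1
with v₂(M) ≤ (L_ℂ(J_{n,k})+n+2)^b has τ(M·J_{n,k}) ≤ (L_ℂ(J_{n,k})+n+2)^b (τ = constant-free
complexity, L_ℂ = complexity over ℂ, J_{n,k} = the k-th inversion jet of det). Verbatim the
hypothesis hCE of `…Theorems.AnyonJets.JetConstantElim.closes_ultimate_twoAdic`; WEAKER than
JetConstantElim 16737 (CE ⇒ CE^ult ⇒ CE^ult₂: `jetConstantElimUltimate_of_jetConstantElim`,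
`jetConstantElimUltimateTwoAdic_of_ultimate`), so the multiplier-removal stub (conjecture-grade; MR
∧ CF ⊢ τ(PER) superpolynomial, p581999) leaves the critical path. LINE (registered content carried
over): `jetConstantElimUltimateTwoAdic_of : stub_algebraicDescent (LANDED p575059) →
stub_integralMultiple₂ (OPEN: number-field constants up to a common denominator N with v₂
polynomially bounded — "no deep towers of 1/2", free when N is odd / constants are algebraic
integers) → stub_signSimulation (LANDED p575638) → CE^ult₂`. SAM -/
@[route_item "route-ValiantsHypothesis-AnyonJets"]
def JetConstantElimTwoAdic : Prop :=
  let J := fun (n k : ℕ) => (∑ σ : Equiv.Perm (Fin n), MvPolynomial.C (((Equiv.Perm.sign σ : ℤˣ) : ℤ) * (((Finset.univ.filter (fun p : Fin n × Fin n => p.1 < p.2 ∧ σ p.2 < σ p.1)).card.choose k : ℕ) : ℤ)) * ∏ i : Fin n, MvPolynomial.X (σ i, i) : MvPolynomial (Fin n × Fin n) ℤ); ∃ b : ℕ, ∀ n k : ℕ, k ≤ Nat.log 2 n → ∃ M : ℕ, 1 ≤ M ∧ padicValNat 2 M ≤ (Literature.Computability.AlgebraicComplexity.complexity (MvPolynomial.map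 (Int.castRingHom ℂ) (J n k)) + n + 2) ^ b ∧ Literature.Computability.AlgebraicComplexity.constantFreeComplexity ((M : ℤ) • J n k) ≤ (Literature.Computability.AlgebraicComplexity.complexity (MvPolynomial.map (Int.castRingHom ℂ) (J n k)) + n + 2) ^ b

/-- item stmt-ValiantsHypothesis-23656 · crux · rank 6 · open · by planner
why it might fail: As a theorem: an explicit fixed-polynomial (n^c for every c) constant-free lower bound at a fixed jet order, nothing beyond Baur-Strassen; via PMPBH a fixed-polynomial Boolean bound for a P-function. False iff shallow jet multiples have one constant-free exponent uniformly in k (collapse of CX15).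
sources: CurticapeanXia2015, Valiant1979Permanent, BjorklundHusfeldtLyckberg2017, BlaeserEngels2019
[crux] CF^ult — CONSTANT-FREE GROWTH OF ALL 2-ADICALLY SHALLOW MULTIPLES OF THE JETS (the RESIDUAL
conjunct of the re-glued `closes`, ⊕W[1]-type; evidence route = PerModPowBooleanHard 16743 via
`cfUltimate_of_perModPowBooleanHard` p583838 — integral multipliers dissolve in the Boolean shadow):
for every c there is a FIXED k ≥ 1 such that for infinitely many n, every M ≥ 1 with v₂(M) ≤ n^c has
n^c ≤ τ(M·J_{n,k}). Verbatim the hypothesis hCF of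
`…Theorems.AnyonJets.JetConstantElim.closes_ultimate_twoAdic`; implies ConstantFreeJetGrowth 16738
(M = 1, `cfGrowth_of_ultimate`). CALIBRATION: consistent with every ceiling in the tree
(JetFlatness: τ(J_{n,k}) = n^{O(k)}; CeilingAllPrecisions: L_{ℤ/2^k}(per_n) = n^{O(k)}); it is NOT
the refuted 21028 OddPerNotVPF2 (that asserted every-exponent hardness at the fixed precision k = 1
and died to the n⁴·L(det_n) circuit) — CF^ult lets each fixed k be n^{O(k)}-easy and only denies a
k-UNIFORM exponent; its quantifier shape ∃k ∀n₀ ∃n is STRONGER than TwoAdicLadder's VH-implied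
PrecisionLadder 5948 (∃ᶠ n, ∃ k(n)): CF^ult is not implied by VH. It is false iff the shallow
multiples of the jets admit constant-free circuits of one exponent uniformly in -/
@[route_item "route-ValiantsHypothesis-AnyonJets"]
def ConstantFreeJetGrowthUltimate : Prop :=
  let J := fun (n k : ℕ) => (∑ σ : Equiv.Perm (Fin n), MvPolynomial.C (((Equiv.Perm.sign σ : ℤˣ) : ℤ) * (((Finset.univ.filter (fun p : Fin n × Fin n => p.1 < p.2 ∧ σ p.2 < σ p.1)).card.choose k : ℕ) : ℤ)) * ∏ i : Fin n, MvPolynomial.X (σ i, i) : MvPolynomial (Fin n × Fin n) ℤ); ∀ c : ℕ, ∃ k : ℕ, 1 ≤ k ∧ ∀ n₀ : ℕ, ∃ n : ℕ, n₀ ≤ n ∧ ∀ M : ℕ, 1 ≤ M → padicValNat 2 M ≤ n ^ c → n ^ c ≤ Literature.Computability.AlgebraicComplexity.constantFreeComplexity ((M : ℤ) • J n k)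

/-- item stmt-ValiantsHypothesis-16737 · aside · rank 2 · open · by planner
why it might fail: Roots of unity or fast-matrix-multiplication constants might save an unbounded polynomial factor on the easy integer families J_k — a VP_ℂ versus VP⁰ gap INSIDE VP at fixed-polynomial granularity; nothing in print excludes it, and the full-range (all k) form already implies TauConstElim.
sources: Burgisser2000, KoiranPerifel2011, BhattacharjeeEtAl2026, Koiran2004, Burgisser2009
[crux] CONSTANT ELIMINATION INSIDE VP FOR THE JETS (card K1, algebraic half): there is one exponent
b such that for all n and all k ≤ log₂ n the constant-free complexity of J_(n,k) is at most
(L_ℂ(J_(n,k)) + n + 2)^b — complex constants buy at most a k-INDEPENDENT polynomial on the explicit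
easy integer families J_k (each already in VP⁰ with τ ≤ n^(4k+O(1))(2k)!). Ranked first: it is the
genuinely algebraic residue of the line and informative either way (a refutation is an unbounded
VP_ℂ/VP⁰ gap on explicit easy polynomials). [difficulty: open-problem] -/
@[route_item "route-ValiantsHypothesis-AnyonJets"]
def JetConstantElim : Prop :=
  let J := fun (n k : ℕ) => (∑ σ : Equiv.Perm (Fin n), MvPolynomial.C (((Equiv.Perm.sign σ : ℤˣ) : ℤ) * (((Finset.univ.filter (fun p : Fin n × Fin n => p.1 < p.2 ∧ σ p.2 < σ p.1)).card.choose k : ℕ) : ℤ)) * ∏ i : Fin n, MvPolynomial.X (σ i, i) : MvPolynomial (Fin n × Fin n) ℤ); ∃ b : ℕ, ∀ n k : ℕ, k ≤ Nat.log 2 n → Literature.Computability.AlgebraicComplexity.constantFreeComplexity (J n k) ≤ (Literature.Computability.AlgebraicComplexity.complexity (MvPolynomial.map (Int.castRingHom ℂ) (J n k)) + n + 2) ^ b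

/-- item stmt-ValiantsHypothesis-16738 · aside · rank 3 · open · by planner
why it might fail: As a theorem it needs explicit fixed-polynomial constant-free lower bounds (n^c for every c at some fixed k) — no technique beyond Baur–Strassen exists; it is false outright only if per mod 2^k has n^O(1)-size Boolean circuits uniformly in k (nonuniform collapse of CX15's ⊕W[1]-hardness).
sources: CurticapeanXia2015, Valiant1979Permanent, BjorklundHusfeldtLyckberg2017, BlaeserEngels2019
[crux] CONSTANT-FREE JET GROWTH (card K1, arithmetic half, io form): for every c there is a fixed k
≥ 1 with τ(J_(n,k)) ≥ n^c for infinitely many n (τ = constant-free fan-in-two complexity over ℤ).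
Fine-grained-safe: by the 2-adic shadow per ≡ Σ_(j<k)(−2)^j J_j (mod 2^k) and Boolean simulation,
its failure puts per mod 2^k into k-uniform polynomial-size Boolean circuits (support
BooleanShadowToCF). [difficulty: open-problem] -/
@[route_item "route-ValiantsHypothesis-AnyonJets"]
def ConstantFreeJetGrowth : Prop :=
  let J := fun (n k : ℕ) => (∑ σ : Equiv.Perm (Fin n), MvPolynomial.C (((Equiv.Perm.sign σ : ℤˣ) : ℤ) * (((Finset.univ.filter (fun p : Fin n × Fin n => p.1 < p.2 ∧ σ p.2 < σ p.1)).card.choose k : ℕ) : ℤ)) * ∏ i : Fin n, MvPolynomial.X (σ i, i) : MvPolynomial (Fin n × Fin n) ℤ); ∀ c : ℕ, ∃ k : ℕ, 1 ≤ k ∧ ∀ n₀ : ℕ, ∃ n : ℕ, n₀ ≤ n ∧ n ^ c ≤ Literature.Computability.AlgebraicComplexity.constantFreeComplexity (J n k)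

-- item stmt-ValiantsHypothesis-24184 · support · rank 5 · open · by planner — informal only, no Lean statement yet:
--   [crux] HNF₂₃ — HEIGHT NORMAL FORM for near-optimal jet circuits (director-valiant g9
--   2026-08-28T00:28Z; tenure g9): every fan-in-2 ℚ̄-circuit Q computing the inversion jet J_{n,k} (k ≤
--   log₂ n) is replaceable by a fan-in-2 circuit Q′ of size ≤ X^a (X = |Q|+n+2) computing the same jet
--   whose 4|Q′|+1 slot constants, after clearing ONE common denominator N ≤ 2^h, are ℤ-combinations of
--   height ≤ 2^h of a ℚ-independent β ∋ 1 (β₀ = 1) with INTEGER multiplication table γ of height ≤ 2^h,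
--   rank d+1 ≤ X^a, h ≤ X^a, and N ODD ∨ fdeg(skeleton Q′) ≤ X^a. Verbatim Lean of census
--   Cruxes/JetConstantElim/INTEGRAL

/-- item stmt-ValiantsHypothesis-16740 · support · rank 9 · closed · proved by Summit.ValiantsHypothesis.ValiantsHypothesis.Theorems.AnyonJets.resummation_proof (prover) · by planner
sources: HungKuo2023, Valiant1979
[support] per_n = Σ_(k=0)^(C(n,2)) (−2)^k J_(n,k) in ℤ[x] (termwise: sgn σ·(1−2)^(inv σ) = 1; inv σ
≤ n(n−1)/2 so the binomial sum is complete); verified exactly for n ≤ 5 (scratch/verify2.py) and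
carried by triage-22/23 of the card. [difficulty: provable-now] -/
@[route_item "route-ValiantsHypothesis-AnyonJets"]
def Resummation : Prop :=
  let J := fun (n k : ℕ) => (∑ σ : Equiv.Perm (Fin n), MvPolynomial.C (((Equiv.Perm.sign σ : ℤˣ) : ℤ) * (((Finset.univ.filter (fun p : Fin n × Fin n => p.1 < p.2 ∧ σ p.2 < σ p.1)).card.choose k : ℕ) : ℤ)) * ∏ i : Fin n, MvPolynomial.X (σ i, i) : MvPolynomial (Fin n × Fin n) ℤ); ∀ n : ℕ, Literature.Computability.AlgebraicComplexity.perPoly (Fin n) ℤ = ∑ k ∈ Finset.range (n * (n - 1) / 2 + 1), ((-2 : ℤ) ^ k) • J n k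

-- `Resummation` holds: proved by `Summit.ValiantsHypothesis.ValiantsHypothesis.Theorems.AnyonJets.resummation_proof` (its module imports this route file, so no `_holds` link can be stated here).

/-- item stmt-ValiantsHypothesis-16741 · support · rank 9 · closed · proved by Summit.ValiantsHypothesis.ValiantsHypothesis.Theorems.AnyonJets.jetFlatness_proof (prover) · by planner
sources: Valiant1979Permanent, Burgisser2000, HungKuo2023
[support] THE LEVER (card P1): J_(n,k) has constant-free circuits of size ≤ (n+2)^(4k+c₀)·(2k+2)! —
J_k = Σ over k-sets S of marked inversion pairs (column pairs) of Σ_(σ ⊇ S-inverted) sgn σ x^σ, and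
for fixed S with touched columns C (|C| ≤ 2k) the inner sum is a Laplace expansion of det along the
columns C with the S-inverted half of each small block kept (≤ n^(2k) sets S, ≤ n^(2k) row sets, ≤
(2k)! small bijections, one division-free det of the complementary minor); for k ≥ n/4 the
monomial-by-monomial circuit is below the bound. J_1 formula verified for n ≤ 5, J_2 decomposition
for n = 4, 5. [difficulty: L] -/
@[route_item "route-ValiantsHypothesis-AnyonJets"]
def JetFlatness : Prop :=
  let J := fun (n k : ℕ) => (∑ σ : Equiv.Perm (Fin n), MvPolynomial.C (((Equiv.Perm.sign σ : ℤˣ) : ℤ) * (((Finset.univ.filter (fun p : Fin n × Fin n => p.1 < p.2 ∧ σ p.2 < σ p.1)).card.choose k : ℕ) : ℤ)) * ∏ i : Fin n, MvPolynomial.X (σ i, i) : MvPolynomial (Fin n × Fin n) ℤ); ∃ c₀ : ℕ, ∀ n k : ℕ, Literature.Computability.AlgebraicComplexity.constantFreeComplexity (J n k) ≤ (n + 2) ^ (4 * k + c₀) * Nat.factorial (2 * k + 2)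

-- `JetFlatness` holds: proved by `Summit.ValiantsHypothesis.ValiantsHypothesis.Theorems.AnyonJets.jetFlatness_proof` (its module imports this route file, so no `_holds` link can be stated here).

/-- item stmt-ValiantsHypothesis-16742 · support · rank 9 · closed · proved by Summit.ValiantsHypothesis.ValiantsHypothesis.Theorems.AnyonJets.twoAdicShadow_proof (prover) · by planner
sources: Valiant1979Permanent, BjorklundHusfeldtLyckberg2017, CurticapeanXia2015
[support] 2-ADIC SHADOW (card P2; offered to route TwoAdicLadder as its missing algebraic n^O(k)
support): per_n − Σ_(k<a)(−2)^k J_(n,k) ∈ 2^a·ℤ[x] for all n, a (from Resummation); a = 2: per ≡ det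
− 2J_1 (mod 4), verified n ≤ 5. [difficulty: provable-now] -/
@[route_item "route-ValiantsHypothesis-AnyonJets"]
def TwoAdicShadow : Prop :=
  let J := fun (n k : ℕ) => (∑ σ : Equiv.Perm (Fin n), MvPolynomial.C (((Equiv.Perm.sign σ : ℤˣ) : ℤ) * (((Finset.univ.filter (fun p : Fin n × Fin n => p.1 < p.2 ∧ σ p.2 < σ p.1)).card.choose k : ℕ) : ℤ)) * ∏ i : Fin n, MvPolynomial.X (σ i, i) : MvPolynomial (Fin n × Fin n) ℤ); ∀ n a : ℕ, ∃ R : MvPolynomial (Fin n × Fin n) ℤ, Literature.Computability.AlgebraicComplexity.perPoly (Fin n) ℤ - ∑ k ∈ Finset.range a, ((-2 : ℤ) ^ k) • J n k = ((2 : ℤ) ^ a) • R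

-- `TwoAdicShadow` holds: proved by `Summit.ValiantsHypothesis.ValiantsHypothesis.Theorems.AnyonJets.twoAdicShadow_proof` (its module imports this route file, so no `_holds` link can be stated here).

/-- item stmt-ValiantsHypothesis-16743 · support · rank 9 · open · by planner
sources: CurticapeanXia2015, Valiant1979Permanent, BjorklundHusfeldtLyckberg2017
[support] BOOLEAN FAR SIDE (believed; CurticapeanXia2015 made nonuniform): for every c some fixed k
≥ 1 has: the k low bits of the 0/1 permanent (per mod 2^k, permutation count inlined as in
`permCount`) admit no B₂-circuits of size ≤ n^c for infinitely many n. Open (any c ≥ 2 is an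
explicit fixed-polynomial Boolean lower bound) but a consequence of nonuniform ⊕W[1]-type
hypotheses; filed so that the constant-free crux has a typed evidence chain. [difficulty:
open-problem] -/
@[route_item "route-ValiantsHypothesis-AnyonJets"]
def PerModPowBooleanHard : Prop :=
  ∀ c : ℕ, ∃ k : ℕ, 1 ≤ k ∧ ∀ n₀ : ℕ, ∃ n : ℕ, n₀ ≤ n ∧ ¬ Literature.Computability.Complexity.CktSize Literature.Computability.Complexity.B2 (fun (y : Fin n × Fin n → Bool) (i : Fin k) => Nat.testBit ((Finset.univ.filter fun σ : Equiv.Perm (Fin n) => ∀ j, y (σ j, j) = true).card) i) (n ^ c)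

/-- item stmt-ValiantsHypothesis-16744 · support · rank 9 · closed · proved by Summit.ValiantsHypothesis.ValiantsHypothesis.Theorems.AnyonJets.booleanShadowToCF_proof (prover) · by planner
sources: Burgisser2000TCS, CurticapeanXia2015, Valiant1979Permanent
[support] the Boolean far side implies ConstantFreeJetGrowth: if for some c every fixed j had
τ(J_(n,j)) < n^c eventually, then for each k the polynomial Σ_(j<k)(−2)^j J_j (≡ per mod 2^k by
TwoAdicShadow; J_0 = det constant-free in n^O(1)) has constant-free size k·n^c + n^O(1), and
Bürgisser's simulation `cktSize_testBits_aeval_eval` (p = 2^k) gives B₂-circuits of size n^(c+O(1))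
for per mod 2^k, eventually, for every k — contradicting PerModPowBooleanHard; pigeonhole is
unnecessary in the io form. [difficulty: provable-now] -/
@[route_item "route-ValiantsHypothesis-AnyonJets"]
def BooleanShadowToCF : Prop :=
  PerModPowBooleanHard → ConstantFreeJetGrowth

-- `BooleanShadowToCF` holds: proved by `Summit.ValiantsHypothesis.ValiantsHypothesis.Theorems.AnyonJets.booleanShadowToCF_proof` (its module imports this route file, so no `_holds` link can be stated here).

/-- item stmt-ValiantsHypothesis-16745 · support · rank 9 · open · by planner
sources: HungKuo2023, CurticapeanXia2015, BlaeserEngels2019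
[support] the card's K1 over ℂ in its strong (tail, eventual) form: there are a, n₀ with n^k ≤
L_ℂ(J_(n,k))^a for all n ≥ n₀ and 1 ≤ k ≤ log₂ n — the jet-cost exponent grows linearly in k along k
≤ log n. Implies the target (GrowthCToTarget, proved in Sketch.lean) and is implied by
ConstantFreeJetGrowth-type growth plus JetConstantElim; filed as the direct (split-free) milestone,
subject to the rank-method barriers the card concedes. [difficulty: open-problem] -/
@[route_item "route-ValiantsHypothesis-AnyonJets"]
def JetCostGrowthC : Prop :=
  let J := fun (n k : ℕ) => (∑ σ : Equiv.Perm (Fin n), MvPolynomial.C (((Equiv.Perm.sign σ : ℤˣ) : ℤ) * (((Finset.univ.filter (fun p : Fin n × Fin n => p.1 < p.2 ∧ σ p.2 < σ p.1)).card.choose k : ℕ) : ℤ)) * ∏ i : Fin n, MvPolynomial.X (σ i, i) : MvPolynomial (Fin n × Fin n) ℤ); ∃ a n₀ : ℕ, ∀ n : ℕ, n₀ ≤ n → ∀ k : ℕ, 1 ≤ k → k ≤ Nat.log 2 n → n ^ k ≤ (Literature.Computability.AlgebraicComplexity.complexity (MvPolynomial.map (Int.castRingHom ℂ) (J n k)))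 ^ a

/-- item stmt-ValiantsHypothesis-16746 · support · rank 9 · closed · proved by Summit.ValiantsHypothesis.ValiantsHypothesis.Theorems.AnyonJets.growthCToTarget_proof (prover) · by planner
sources: Burgisser2000
[support] JetCostGrowthC → JetExponentUnbounded (ℕ-arithmetic: at k = c·a + 1 and n ≥ 2^k + 2,
n^(ca+1) ≤ L^a and L ≤ n^c are incompatible); proved sorry-free as `growthCToTarget_holds` in the
planner's Sketch.lean. [difficulty: provable-now] -/
@[route_item "route-ValiantsHypothesis-AnyonJets"]
def GrowthCToTarget : Prop :=
  JetCostGrowthC → JetExponentUnbounded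

-- `GrowthCToTarget` holds: proved by `Summit.ValiantsHypothesis.ValiantsHypothesis.Theorems.AnyonJets.growthCToTarget_proof` (its module imports this route file, so no `_holds` link can be stated here).

/-- item stmt-ValiantsHypothesis-16747 · support · rank 9 · open · by planner
sources: HungKuo2023, DeRugyAltherre2013, Curticapean2021, MertensMoore2013
[support] card K2 in implication form (structural, not load-bearing for `closes`): for algebraic z ∉
{0, 1, −1} the fibre (P(z;X_n))_n of the inversion pencil is a VP family only if the permanent is —
every non-flat algebraic anyon is as hard as the boson (expected via VNP-completeness under
c-reductions; Hung–Kuo have Boolean Mod_pP-hardness at ζ_(p^k), odd p, and leave real z and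
composite orders open). [difficulty: open-problem] -/
@[route_item "route-ValiantsHypothesis-AnyonJets"]
def NoThirdEasyFibre : Prop :=
  ∀ z : ℂ, IsAlgebraic ℚ z → z ≠ 0 → z ≠ 1 → z ≠ -1 → Literature.Computability.AlgebraicComplexity.IsVPFamily (fun n => (∑ σ : Equiv.Perm (Fin n), MvPolynomial.C (z ^ (Finset.univ.filter (fun p : Fin n × Fin n => p.1 < p.2 ∧ σ p.2 < σ p.1)).card) * ∏ i : Fin n, MvPolynomial.X (σ i, i) : MvPolynomial (Fin n × Fin n) ℂ)) → Literature.Computability.AlgebraicComplexity.IsVPFamily (fun n => Literature.Computability.AlgebraicComplexity.perPoly (Fin n) ℂ)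

/-- item stmt-ValiantsHypothesis-16748 · support · rank 9 · closed · proved by Summit.ValiantsHypothesis.ValiantsHypothesis.Theorems.AnyonJets.transcendentalFibre_proof (prover) · by planner
sources: HungKuo2023, Burgisser2000, Valiant1979
[support] card P3 (fibre criterion, nontrivial direction): for transcendental z, if (P(z;X_n))_n is
a VP family then so is the permanent — for a fixed size bound the easy locus {q₀ : P(q₀;X_n) has a
size-s circuit} is ℚ-constructible (Chevalley over the finitely many skeletons), hence
finite-algebraic or cofinite, and a transcendental easy point makes it cofinite, so per = P(1) is
Lagrange-interpolated from C(n,2)+1 easy fibres; hence VH ⟺ hardness of any transcendental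
(equivalently the generic) anyon permanent. [difficulty: L] -/
@[route_item "route-ValiantsHypothesis-AnyonJets"]
def TranscendentalFibre : Prop :=
  ∀ z : ℂ, Transcendental ℚ z → Literature.Computability.AlgebraicComplexity.IsVPFamily (fun n => (∑ σ : Equiv.Perm (Fin n), MvPolynomial.C (z ^ (Finset.univ.filter (fun p : Fin n × Fin n => p.1 < p.2 ∧ σ p.2 < σ p.1)).card) * ∏ i : Fin n, MvPolynomial.X (σ i, i) : MvPolynomial (Fin n × Fin n) ℂ)) → Literature.Computability.AlgebraicComplexity.IsVPFamily (fun n => Literature.Computability.AlgebraicComplexity.perPoly (Fin n) ℂ)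

-- `TranscendentalFibre` holds: proved by `Summit.ValiantsHypothesis.ValiantsHypothesis.Theorems.AnyonJets.transcendentalFibre_proof` (its module imports this route file, so no `_holds` link can be stated here).

/-- item stmt-ValiantsHypothesis-16749 · support · rank 9 · closed · proved by Summit.ValiantsHypothesis.ValiantsHypothesis.Theorems.AnyonJets.crossingNestingTwist_proof (prover) · by planner
sources: Blitvic2012, Valiant1979
[support] companion card crossing-pencil-free-and-fermion, twist identity behind the reduction of
the (q,t)-Wick plane to ONE crossing pencil: for a perfect matching M of Fin (2n) (fixed-point-free
involution), Σ_(openers a<Ma) (Ma − a − 1) = 2·(cr(M) + ne(M)) (each interior point of an arc is an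
endpoint of a nested arc — two per nesting — or of a crossing arc — one per side); hence (−1)^(ne) =
(−1)^(cr)·Π i^(b−a−1), the fermion line of twisted Pfaffians and Hf = Σ 2^k Ĵ_k, NN = Σ_k J^(ne)_k
(route FifoMatching's NN, stmt-11615/11616); verified on all 1/3/15/105/945 matchings of [2],…,[10].
[difficulty: provable-now] -/
@[route_item "route-ValiantsHypothesis-AnyonJets"]
def CrossingNestingTwist : Prop :=
  ∀ (n : ℕ) (M : Equiv.Perm (Fin (2 * n))), (∀ i, M (M i) = i) → (∀ i, M i ≠ i) → ∑ i ∈ Finset.univ.filter (fun i : Fin (2 * n) => i < M i), ((M i : ℕ) - (i : ℕ) - 1) = 2 * ((Finset.univ.filter (fun p : Fin (2 * n) × Fin (2 * n) => p.1 < p.2 ∧ p.2 < M p.1 ∧ M p.1 < M p.2)).card + (Finset.univ.filter (fun p : Fin (2 * n) × Fin (2 * n) => p.1 < p.2 ∧ p.2 < M p.2 ∧ M p.2 < M p.1)).card)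

-- `CrossingNestingTwist` holds: proved by `Summit.ValiantsHypothesis.ValiantsHypothesis.Theorems.AnyonJets.crossingNestingTwist_proof` (its module imports this route file, so no `_holds` link can be stated here).

/-- item stmt-ValiantsHypothesis-16750 · assembly · rank 1 · closed · proved by Summit.ValiantsHypothesis.ValiantsHypothesis.Theorems.AnyonJets.assembly_proof (prover) · by planner
sources: Valiant1979, Burgisser2000
[assembly] ConstantFreeJetGrowth → JetConstantElim → UniformJetUpperBound → ValiantsHypothesis
(exactly `closes`; `assembly_holds` in Sketch.lean). -/
@[route_item "route-ValiantsHypothesis-AnyonJets"]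
def Assembly : Prop :=
  ConstantFreeJetGrowth → JetConstantElim → UniformJetUpperBound → _root_.ValiantsHypothesis

-- `Assembly` holds: proved by `Summit.ValiantsHypothesis.ValiantsHypothesis.Theorems.AnyonJets.assembly_proof` (its module imports this route file, so no `_holds` link can be stated here).

/-! D-0027 §2.1 — DECIDING THEOREM (planner-authored via `route open/edit --closes-file`; by operator:999:1161899 2026-08-27T23:37:24Z):
its hypotheses are this route's items and its conclusion the sub-problem Statement (glue_lint), and it elaborates with this file. -/

@[closes "route-ValiantsHypothesis-AnyonJets"] theorem closes (hCF : ConstantFreeJetGrowthUltimate) (hCE : JetConstantElimTwoAdic)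
    (hU : UniformJetUpperBound) : _root_.ValiantsHypothesis := by
  show Literature.Computability.AlgebraicComplexity.VP ℂ ≠ Literature.Computability.AlgebraicComplexity.VNP ℂ
  intro hEq
  obtain ⟨c, n₀, hc⟩ := hU hEq
  obtain ⟨b, hb⟩ := hCE
  obtain ⟨k, hk1, hk⟩ := hCF ((c + 2) * b + 1)
  obtain ⟨n, hn, hτ⟩ := hk (max n₀ (max (2 ^ k) 3))
  have hn₀ : n₀ ≤ n := le_trans (le_max_left _ _) hn
  have h2k : 2 ^ k ≤ n := le_trans (le_trans (le_max_left _ _) (le_max_right _ _)) hn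
  have h3 : 3 ≤ n := le_trans (le_trans (le_max_right _ _) (le_max_right _ _)) hn
  have hklog : k ≤ Nat.log 2 n := Nat.le_log_of_pow_le (by norm_num) h2k
  obtain ⟨M, hM, hvM, hτM⟩ := hb n k hklog
  have hUn := hc n hn₀ k
  -- abbreviate the complex complexity of the jet J n k
  set L := Literature.Computability.AlgebraicComplexity.complexity (MvPolynomial.map (Int.castRingHom ℂ)
    (∑ σ : Equiv.Perm (Fin n), MvPolynomial.C (((Equiv.Perm.sign σ : ℤˣ) : ℤ) * (((Finset.univ.filter (fun p : Fin n × Fin n => p.1 < p.2 ∧ σ p.2 < σ p.1)).card.choose k : ℕ) : ℤ)) * ∏ i : Fin n, MvPolynomial.X (σ i, i) : MvPolynomial (Fin n × Fin n) ℤ)) with hL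
  have hn1 : 1 ≤ n := by omega
  have hpow1 : n ≤ n ^ (c + 1) := by
    calc n = n ^ 1 := (pow_one n).symm
      _ ≤ n ^ (c + 1) := Nat.pow_le_pow_right hn1 (by omega)
  have hpow2 : n ^ c ≤ n ^ (c + 1) := Nat.pow_le_pow_right hn1 (by omega)
  have hsum : L + n + 2 ≤ n ^ (c + 2) := by
    have : L + n + 2 ≤ 3 * n ^ (c + 1) := by omega
    calc L + n + 2 ≤ 3 * n ^ (c + 1) := this
      _ ≤ n * n ^ (c + 1) := Nat.mul_le_mul_right _ h3
      _ = n ^ (c + 2) := by ring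
  have hXb : (L + n + 2) ^ b ≤ n ^ ((c + 2) * b) := by
    calc (L + n + 2) ^ b ≤ (n ^ (c + 2)) ^ b := Nat.pow_le_pow_left hsum b
      _ = n ^ ((c + 2) * b) := by rw [← pow_mul]
  have hlt : n ^ ((c + 2) * b) < n ^ ((c + 2) * b + 1) := Nat.pow_lt_pow_right (by omega) (by omega)
  have hv : padicValNat 2 M ≤ n ^ ((c + 2) * b + 1) := by omega
  have hchain : n ^ ((c + 2) * b + 1) ≤ n ^ ((c + 2) * b) :=
    calc n ^ ((c + 2) * b + 1)
        ≤ Literature.Computability.AlgebraicComplexity.constantFreeComplexity ((M : ℤ) • (∑ σ : Equiv.Perm (Fin n), MvPolynomial.C (((Equiv.Perm.sign σ : ℤˣ) : ℤ) * (((Finset.univ.filter (fun p : Fin n × Fin n => p.1 < p.2 ∧ σ p.2 < σ p.1)).card.choose k : ℕ) : ℤ)) * ∏ i : Fin n, MvPolynomial.X (σ i, i) : MvPolynomial (Fin n × Fin n) ℤ)) := hτ M hM hv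
      _ ≤ (L + n + 2) ^ b := hτM
      _ ≤ n ^ ((c + 2) * b) := hXb
  omega

end Summit.ValiantsHypothesis.ValiantsHypothesis.Theses.AnyonJets
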